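import Literature.Analysis.Matrix.CoerciveCombesThomas

/-!
# `T4Continuum.ShellMeasurePropagatorSectionAccretive` — SECTIONING KEEPS THE GAP, THE RANGE AND THE ROW SUMS:
# the principal (Dirichlet) restriction of an `m`-accretive range-one lattice operator is `m`-accretive and range one,
# so its inverse obeys the SAME Combes–Thomas decay, uniformly in the section

(cell `pub-balaban`, sub-cell `t4`, NE7c (node U5b); OWNER unit `b2b-balaban-t4-ne7c-p1` gen 37; estimate lane, species (α)
of the owner's γ18 FLOOR memo, item (α4) «block sectioning with exterior frozen» of ruling R-ne7cp1-g37-4; companion of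
leaf-02-g13's `ShellMeasurePropagatorCombesThomas{Prelims,}` (second-order Combes–Thomas, uniform in the lattice spacing);
imports `Literature.Analysis.Matrix.CoerciveCombesThomas` ONLY; [folklore]; 0 `def`, 0 `def … : Prop`, 0 sorry, 0 cite)

HONEST FRAMING.  Finite four-torus programme, rung (B)+1 only — NOT infinite volume, NOT a mass gap, NOT the Clay problem, NOT
summit progress.  NE7c (`T4IndicatorShell.ShellWeightBound`) is NOT PRINTED in [Balaban 1983–89] and NOT PROVED.  This file is a
lemma of OURS about abstract finite matrices; it touches no END host, no row of the owner table, no link of the v5∕v6 chains, and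
moves NO census count.  What it says for the wall: of the four parts of species (α) (R-ne7cp1-g37-4: (α1) a V-uniform GAP, (α2)
decay from the gap, (α3) the ℓ² → weighted-sup upgrade, (α4) block sectioning), part (α4) is SOFT at the ℓ²-entry level —
restricting an accretive range-one operator to ANY index subset (the block, exterior frozen = Dirichlet data) keeps accretivity
with the same `m`, range one, and the off-site row∕column sums, hence (by the tree's `accretive_combes_thomas`) the sectioned
inverse decays with the SAME constants for EVERY section.  It does NOT produce the gap (α1), the norm upgrade (α3), or anything
about Bałaban's operators.  HONEST DEPENDENCY (cell): continuum YM on T⁴ ⇐ BetaPertH ∧ nine spine estimates (0/9 proved);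
BetaPertH ⇐ (D1) ∧ (D4) ∧ CAP+tail; G-an2-4 gates asym, D1 and NE2/3/4.
-/

noncomputable section

open Finset
open scoped Matrix ComplexConjugate

namespace Summit.QuantumFields.BalabanUV.T4Continuum.ShellMeasurePropagatorSectionAccretive

variable {ι : Type*} [Fintype ι] (p : ι → Prop) [DecidablePred p]

/-- The squared ℓ²-norm of the zero extension of a section vector equals that of the section vector. [folklore] -/
theorem sum_norm_sq_ext_zero (w : {i // p i} → ℂ) :
    ∑ i, ‖(fun k => if h : p k then w ⟨k, h⟩ else 0) i‖ ^ 2 = ∑ x : {i // p i}, ‖w x‖ ^ 2 := by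
  have h1 : ∑ i, ‖(fun k => if h : p k then w ⟨k, h⟩ else 0) i‖ ^ 2
      = ∑ i ∈ univ.filter p, ‖(fun k => if h : p k then w ⟨k, h⟩ else 0) i‖ ^ 2 := by
    rw [Finset.sum_filter]
    refine Finset.sum_congr rfl fun i _ => ?_
    by_cases hi : p i
    · simp [hi]
    · simp [hi]
  rw [h1, Finset.sum_subtype (univ.filter p) (p := p) (by simp)]
  refine Finset.sum_congr rfl fun x _ => ?_
  simp [x.2]

/-- The principal submatrix on the section, applied to `w`, is the full matrix applied to the zero extension, read on the
section. [folklore] -/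
theorem submatrix_mulVec_eq (A : Matrix ι ι ℂ) (w : {i // p i} → ℂ) (x : {i // p i}) :
    (A.submatrix Subtype.val Subtype.val *ᵥ w) x
      = (A *ᵥ fun k => if h : p k then w ⟨k, h⟩ else 0) x.1 := by
  simp only [Matrix.mulVec, dotProduct, Matrix.submatrix_apply]
  have h1 : ∑ j, A x.1 j * (fun k => if h : p k then w ⟨k, h⟩ else 0) j
      = ∑ j ∈ univ.filter p, A x.1 j * (fun k => if h : p k then w ⟨k, h⟩ else 0) j := by
    rw [Finset.sum_filter]
    refine Finset.sum_congr rfl fun j _ => ?_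
    by_cases hj : p j
    · simp [hj]
    · simp [hj]
  rw [h1, Finset.sum_subtype (univ.filter p) (p := p) (by simp)]
  refine Finset.sum_congr rfl fun y _ => ?_
  simp [y.2]

/-- The sesquilinear form of the submatrix on `w` equals that of the full matrix on the zero extension. [folklore] -/
theorem sum_star_mul_submatrix_mulVec (A : Matrix ι ι ℂ) (w : {i // p i} → ℂ) :
    ∑ x : {i // p i}, star (w x) * (A.submatrix Subtype.val Subtype.val *ᵥ w) x
      = ∑ i, star ((fun k => if h : p k then w ⟨k, h⟩ else 0) i)
          * (A *ᵥ fun k => if h : p k then w ⟨k, h⟩ else 0) i := by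
  symm
  have h1 : ∑ i, star ((fun k => if h : p k then w ⟨k, h⟩ else 0) i)
          * (A *ᵥ fun k => if h : p k then w ⟨k, h⟩ else 0) i
      = ∑ i ∈ univ.filter p, star ((fun k => if h : p k then w ⟨k, h⟩ else 0) i)
          * (A *ᵥ fun k => if h : p k then w ⟨k, h⟩ else 0) i := by
    rw [Finset.sum_filter]
    refine Finset.sum_congr rfl fun i _ => ?_
    by_cases hi : p i
    · simp [hi]
    · simp [hi]
  rw [h1, Finset.sum_subtype (univ.filter p) (p := p) (by simp)]
  refine Finset.sum_congr rfl fun x _ => ?_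
  rw [submatrix_mulVec_eq]
  simp [x.2]

/-- **SECTIONING KEEPS THE GAP.**  If `A` is `m`-accretive on the whole index set, its principal submatrix on ANY section
`{i // p i}` is `m`-accretive with the same `m` (test against zero extensions). [folklore] -/
theorem accretive_submatrix (A : Matrix ι ι ℂ) {m : ℝ}
    (hacc : ∀ v : ι → ℂ, m * ∑ i, ‖v i‖ ^ 2 ≤ (∑ i, star (v i) * (A *ᵥ v) i).re) :
    ∀ w : {i // p i} → ℂ, m * ∑ x, ‖w x‖ ^ 2
      ≤ (∑ x, star (w x) * (A.submatrix Subtype.val Subtype.val *ᵥ w) x).re := by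
  intro w
  rw [← sum_norm_sq_ext_zero p w, sum_star_mul_submatrix_mulVec p A w]
  exact hacc _

omit [Fintype ι] [DecidablePred p] in
/-- Sectioning keeps RANGE ONE (for the restricted pseudo-metric). [folklore] -/
theorem range_one_submatrix (dist : ι → ι → ℕ) (A : Matrix ι ι ℂ) (hrange : ∀ i j, A i j ≠ 0 → dist i j ≤ 1) :
    ∀ x y : {i // p i}, A.submatrix Subtype.val Subtype.val x y ≠ 0 → dist x.1 y.1 ≤ 1 :=
  fun x y h => hrange x.1 y.1 (by simpa [Matrix.submatrix_apply] using h)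

/-- Sectioning does not increase the off-site absolute ROW sums. [folklore] -/
theorem rowSum_submatrix_le (dist : ι → ι → ℕ) (A : Matrix ι ι ℂ) {h : ℝ}
    (hrow : ∀ i, ∑ j ∈ univ.filter (fun j => dist i j ≠ 0), ‖A i j‖ ≤ h) (x : {i // p i}) :
    ∑ y ∈ univ.filter (fun y : {i // p i} => dist x.1 y.1 ≠ 0), ‖A.submatrix Subtype.val Subtype.val x y‖ ≤ h := by
  refine le_trans ?_ (hrow x.1)
  rw [Finset.sum_filter, Finset.sum_filter]
  have h1 : ∑ y : {i // p i}, (if dist x.1 y.1 ≠ 0 then ‖A.submatrix Subtype.val Subtype.val x y‖ else 0)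
      = ∑ j ∈ univ.filter p, (if dist x.1 j ≠ 0 then ‖A x.1 j‖ else 0) := by
    rw [Finset.sum_subtype (univ.filter p) (p := p) (by simp)]
    refine Finset.sum_congr rfl fun y _ => ?_
    simp [Matrix.submatrix_apply]
  rw [h1]
  exact Finset.sum_le_univ_sum_of_nonneg fun j => by split_ifs <;> positivity

/-- Sectioning does not increase the off-site absolute COLUMN sums. [folklore] -/
theorem colSum_submatrix_le (dist : ι → ι → ℕ) (A : Matrix ι ι ℂ) {h : ℝ}
    (hcol : ∀ j, ∑ i ∈ univ.filter (fun i => dist i j ≠ 0), ‖A i j‖ ≤ h) (y : {i // p i}) :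
    ∑ x ∈ univ.filter (fun x : {i // p i} => dist x.1 y.1 ≠ 0), ‖A.submatrix Subtype.val Subtype.val x y‖ ≤ h := by
  refine le_trans ?_ (hcol y.1)
  rw [Finset.sum_filter, Finset.sum_filter]
  have h1 : ∑ x : {i // p i}, (if dist x.1 y.1 ≠ 0 then ‖A.submatrix Subtype.val Subtype.val x y‖ else 0)
      = ∑ i ∈ univ.filter p, (if dist i y.1 ≠ 0 then ‖A i y.1‖ else 0) := by
    rw [Finset.sum_subtype (univ.filter p) (p := p) (by simp)]
    refine Finset.sum_congr rfl fun x _ => ?_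
    simp [Matrix.submatrix_apply]
  rw [h1]
  exact Finset.sum_le_univ_sum_of_nonneg fun i => by split_ifs <;> positivity

/-- **THE SECTIONED INVERSE DECAYS WITH THE SAME CONSTANTS, FOR EVERY SECTION.**  Under the hypotheses of the tree's
`Literature.Analysis.Matrix.accretive_combes_thomas` on the WHOLE index set (range one, off-site row∕column sums `≤ h`,
`m`-accretivity, `h(e^θ − 1) ≤ m/2`), the principal submatrix on any section `{i // p i}` is invertible and
`‖(A_p)⁻¹ x y‖ ≤ (2/m) e^{−θ·dist(x,y)}` — the constants `m, θ` do not see the section.  (Species (α), part (α4) of the NE7c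
γ18 memo: «exterior frozen = Dirichlet restriction» is soft at the ℓ²-entry level; the GAP `hacc` is the hypothesis of
printed TYPE, asserted by nobody here.) [folklore] -/
theorem accretive_combes_thomas_submatrix [DecidableEq ι] (dist : ι → ι → ℕ) (hd0 : ∀ i, dist i i = 0)
    (hds : ∀ i j, dist i j = dist j i) (hdt : ∀ i j k, dist i k ≤ dist i j + dist j k)
    (A : Matrix ι ι ℂ) (hrange : ∀ i j, A i j ≠ 0 → dist i j ≤ 1) (h : ℝ)
    (hrow : ∀ i, ∑ j ∈ univ.filter (fun j => dist i j ≠ 0), ‖A i j‖ ≤ h)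
    (hcol : ∀ j, ∑ i ∈ univ.filter (fun i => dist i j ≠ 0), ‖A i j‖ ≤ h)
    (m θ : ℝ) (hm : 0 < m) (hθ : 0 ≤ θ)
    (hacc : ∀ v : ι → ℂ, m * ∑ i, ‖v i‖ ^ 2 ≤ (∑ i, star (v i) * (A *ᵥ v) i).re)
    (hη : h * (Real.exp θ - 1) ≤ m / 2) :
    IsUnit (A.submatrix (Subtype.val : {i // p i} → ι) Subtype.val).det ∧
      ∀ x y : {i // p i}, ‖(A.submatrix Subtype.val Subtype.val)⁻¹ x y‖
        ≤ 2 / m * Real.exp (-(θ * dist x.1 y.1)) :=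
  Literature.Analysis.Matrix.accretive_combes_thomas (fun x y : {i // p i} => dist x.1 y.1) (fun x => hd0 x.1)
    (fun x y => hds x.1 y.1) (fun x y z => hdt x.1 y.1 z.1) _ (range_one_submatrix p dist A hrange) h
    (rowSum_submatrix_le p dist A hrow) (colSum_submatrix_le p dist A hcol) m θ hm hθ
    (accretive_submatrix p A hacc) hη

/-- G-1 (non-vacuity of the binder shapes): for the IDENTITY operator on any finite index set (range one for every
pseudo-metric, zero off-site sums, `1`-accretive) every section is admitted, with `θ` arbitrary (`h = 0`). [folklore] -/
example [DecidableEq ι] (dist : ι → ι → ℕ) (hd0 : ∀ i, dist i i = 0) (hds : ∀ i j, dist i j = dist j i)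
    (hdt : ∀ i j k, dist i k ≤ dist i j + dist j k) (θ : ℝ) (hθ : 0 ≤ θ) :
    IsUnit ((1 : Matrix ι ι ℂ).submatrix (Subtype.val : {i // p i} → ι) Subtype.val).det ∧
      ∀ x y : {i // p i}, ‖((1 : Matrix ι ι ℂ).submatrix Subtype.val Subtype.val)⁻¹ x y‖
        ≤ 2 / 1 * Real.exp (-(θ * dist x.1 y.1)) := by
  refine accretive_combes_thomas_submatrix p dist hd0 hds hdt (1 : Matrix ι ι ℂ) ?_ 0 ?_ ?_ 1 θ one_pos hθ ?_ ?_
  · intro i j hij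
    by_cases h : i = j
    · subst h; rw [hd0]; exact zero_le_one
    · exact absurd (by simp [h]) hij
  · intro i
    refine le_of_eq (Finset.sum_eq_zero fun j hj => ?_)
    have hne : i ≠ j := by
      intro hij; subst hij; simp [hd0] at hj
    simp [hne]
  · intro j
    refine le_of_eq (Finset.sum_eq_zero fun i hi => ?_)
    have hne : i ≠ j := by
      intro hij; subst hij; simp [hd0] at hi
    simp [hne]
  · intro v
    rw [Matrix.one_mulVec, one_mul]
    have h2 : (∑ i, star (v i) * v i) = ((∑ i, ‖v i‖ ^ 2 : ℝ) : ℂ) := by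
      push_cast
      refine Finset.sum_congr rfl fun i _ => ?_
      rw [Complex.star_def, Complex.conj_mul']
    rw [h2, Complex.ofReal_re]
  · rw [zero_mul]; positivity

end Summit.QuantumFields.BalabanUV.T4Continuum.ShellMeasurePropagatorSectionAccretive

end
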